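import Summits.NavierStokesRegularity.NavierStokesRegularity.Theorems.ExtremiserTransienceZoneTransversalityDefs
import Summits.NavierStokesRegularity.NavierStokesRegularity.Theorems.ExtremiserTransienceKStarAttainedHalfSpaceVariation
import HarnessLib

/-!
# Route `ExtremiserTransience`, crux `NearExtremalTransiencePerFlow` (stmt-NavierStokesRegularity-26567),
# LINE g12-α `transience_exit` (ns-idea-5 g12): THE THREE STATEMENTS OF THE LINE (texts of record)

Texts of record, VERBATIM §1 of the registered skeleton
`Summits/NavierStokesRegularity/NavierStokesRegularity/Cruxes/NearExtremalTransiencePerFlow/Lines/transience_exit.lean`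
(planner ns-idea-5 g12, crux-write 0e87ffb200ce, lines :75 / :93 / :116), so that the by-text stubs
W `stub_violatorWindows : ViolatorWindows` and G `stub_forwardGapCovering : ForwardGapCovering` can be landed as Theorems
files concluding the statements BY NAME (a Theorems file may not import a `Cruxes/` skeleton), and so that the heart
X `NearExtremalExit` has a Theorems-side name:

* `NearExtremalExit` — X, the HEART (OPEN): the universal short-time exit law for near-extremal Taylor-locked slices;
* `ViolatorWindows` — W (flow side): late windows of a violator with small inefficient log-mass and a log-dense measurable set of
  locked efficient times carrying X-ready height packages;
* `ForwardGapCovering` — G (pure real analysis): the one-sided covering lemma in logarithmic backward time (proved: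
  `TransienceExit.forwardGapCovering_holds`, p718391, whose type is this body verbatim).

The three definitions are definitionally equal to the skeleton's (same bodies, same opens), so a theorem `… : ViolatorWindows`
proved against this file closes the skeleton's `sorry` by `exact`.  HONEST FRAMING: definitions only; X, the crux ⟨26567⟩ and
NS regularity are OPEN; nothing about Navier–Stokes regularity or blow-up is proved; no summit is proved by a line.
-/

noncomputable section

open scoped Topology InnerProductSpace RealInnerProductSpace ENNReal ContDiff
open MeasureTheory Filter Set Metric
open Literature.Analysis.FluidPDE
open Summit.NavierStokesRegularity.NavierStokesRegularity.Theorems.DepletionLadder.KStar.HalfSpace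
open Summit.NavierStokesRegularity.NavierStokesRegularity.Theorems.NearExtremalTransiencePerFlow.ZoneTransversality

namespace Summit.NavierStokesRegularity.NavierStokesRegularity.Theorems.NearExtremalTransiencePerFlow.TransienceExit

-- the summit's namespace repeats the problem name by convention (D-0017)
set_option linter.dupNamespace false
set_option linter.style.longLine false

/-- **X — NEAR-EXTREMAL EXIT (HEART, OPEN).**  For classical Leray–Hopf flows from rapidly decaying data on `[0,T) × ℝ³` (any `ν, T`):
a strictly `(κ⋆−δ)`-efficient, Taylor-locked slice at time `t` with height bound `M`, gradient `≤ G M²/ν` and heights `≤ H M` on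
`[t, t + 2τ₁ν/M²]` is followed, on the delayed window `[t + τ₁ν/M², t + 2τ₁ν/M²]`, by slices obeying the flow-wise depletion clause
with coefficient `κ⋆ − ε` at every height bound.  `∀ Θ G H > 0 ∃ τ₀ > 0 ∀ τ₁ ∈ (0,τ₀] ∃ δ ε > 0`. -/
def NearExtremalExit : Prop :=
  ∀ (Θ G H : ℝ), 0 < Θ → 0 < G → 0 < H → ∃ τ₀ : ℝ, 0 < τ₀ ∧ ∀ τ₁ : ℝ, 0 < τ₁ → τ₁ ≤ τ₀ →
    ∃ δ ε : ℝ, 0 < δ ∧ 0 < ε ∧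
    ∀ (ν T : ℝ), 0 < ν → 0 < T →
    ∀ (u : ℝ → EuclideanSpace ℝ (Fin 3) → EuclideanSpace ℝ (Fin 3)) (p : ℝ → EuclideanSpace ℝ (Fin 3) → ℝ),
      IsClassicalNSSolutionOn (Set.Ico 0 T) ν 0 u p → IsLerayHopfOn T ν 0 (u 0) u → HasRapidSpatialDecay (u 0) →
    ∀ (t M : ℝ), 0 ≤ t → 0 < M → t + 2 * τ₁ * ν / M ^ 2 < T →
      (∀ x, ‖u t x‖ ≤ M) →
      (kStar - δ) * M * Real.sqrt (∫ x, ‖curl (u t) x‖ ^ 2) * Real.sqrt (∫ x, frobeniusNormSq (fderiv ℝ (curl (u t)) x)) <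
        |∫ x, ⟪curl (u t) x, fderiv ℝ (u t) x (curl (u t) x)⟫_ℝ| →
      (∫ x, ‖curl (u t) x‖ ^ 2) ≤ Θ * (ν / M) ^ 2 * (∫ x, frobeniusNormSq (fderiv ℝ (curl (u t)) x)) →
      (∀ x, ‖fderiv ℝ (u t) x‖ ≤ G * M ^ 2 / ν) →
      (∀ t' ∈ Set.Icc t (t + 2 * τ₁ * ν / M ^ 2), ∀ x, ‖u t' x‖ ≤ H * M) →
    ∀ t' ∈ Set.Icc (t + τ₁ * ν / M ^ 2) (t + 2 * τ₁ * ν / M ^ 2), ∀ M' : ℝ, (∀ x, ‖u t' x‖ ≤ M') →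
      |∫ x, ⟪curl (u t') x, fderiv ℝ (u t') x (curl (u t') x)⟫_ℝ| ≤
        (kStar - ε) * M' * Real.sqrt (∫ x, ‖curl (u t') x‖ ^ 2) * Real.sqrt (∫ x, frobeniusNormSq (fderiv ℝ (curl (u t')) x))

/-- **W — VIOLATOR WINDOWS (flow side, PROVABLE from the landed log-density theorems and rates).**  See the module docstring. -/
def ViolatorWindows : Prop :=
  ∀ (C ν T : ℝ) (u : ℝ → EuclideanSpace ℝ (Fin 3) → EuclideanSpace ℝ (Fin 3)) (p : ℝ → EuclideanSpace ℝ (Fin 3) → ℝ),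
    IsViolator C ν T u p →
    ∃ (k : ℝ → ℝ) (Θ G H c_w c_lo c_hi d : ℝ), Measurable k ∧ (∀ τ, 0 ≤ k τ ∧ k τ ≤ 1) ∧
      (∀ t ∈ Set.Ico 0 T, ∀ m : ℝ, 0 ≤ m → m < k t → ∃ M : ℝ, (∀ x, ‖u t x‖ ≤ M) ∧
        m * M * Real.sqrt (∫ x, ‖curl (u t) x‖ ^ 2) * Real.sqrt (∫ x, frobeniusNormSq (fderiv ℝ (curl (u t)) x)) <
          |∫ x, ⟪curl (u t) x, fderiv ℝ (u t) x (curl (u t) x)⟫_ℝ|) ∧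
      0 < Θ ∧ 0 < G ∧ 0 < H ∧ 0 < c_w ∧ 0 < c_lo ∧ c_lo ≤ c_hi ∧ 0 < d ∧
      ∀ m : ℝ, kStar / 2 ≤ m → m < kStar → ∀ η : ℝ, 0 < η → ∀ L : ℝ,
        ∃ t₁ t : ℝ, 0 ≤ t₁ ∧ t₁ < t ∧ t < T ∧ L ≤ Real.log ((T - t₁) / (T - t)) ∧
          (∫ τ in t₁..t, Set.indicator {σ : ℝ | k σ ≤ m} (fun _ => (1 : ℝ)) τ / (T - τ)) ≤ η * Real.log ((T - t₁) / (T - t)) ∧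
          ∃ S : Set ℝ, MeasurableSet S ∧ S ⊆ Set.Icc t₁ t ∧
            d * Real.log ((T - t₁) / (T - t)) ≤ (∫ τ in t₁..t, Set.indicator S (fun _ => (1 : ℝ)) τ / (T - τ)) ∧
            ∀ τ ∈ S, m < k τ ∧ ∃ M : ℝ, 0 < M ∧ (∀ x, ‖u τ x‖ ≤ M) ∧
              m * M * Real.sqrt (∫ x, ‖curl (u τ) x‖ ^ 2) * Real.sqrt (∫ x, frobeniusNormSq (fderiv ℝ (curl (u τ)) x)) <
                |∫ x, ⟪curl (u τ) x, fderiv ℝ (u τ) x (curl (u τ) x)⟫_ℝ| ∧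
              (∫ x, ‖curl (u τ) x‖ ^ 2) ≤ Θ * (ν / M) ^ 2 * (∫ x, frobeniusNormSq (fderiv ℝ (curl (u τ)) x)) ∧
              (∀ x, ‖fderiv ℝ (u τ) x‖ ≤ G * M ^ 2 / ν) ∧
              c_lo * ν ≤ M ^ 2 * (T - τ) ∧ M ^ 2 * (T - τ) ≤ c_hi * ν ∧
              τ + c_w * ν / M ^ 2 < T ∧
              (∀ t' ∈ Set.Icc τ (τ + c_w * ν / M ^ 2), ∀ x, ‖u t' x‖ ≤ H * M)

/-- **G — FORWARD-GAP COVERING LEMMA (pure real analysis, PROVABLE).**  See the module docstring. -/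
def ForwardGapCovering : Prop :=
  ∀ a₁ a₂ : ℝ, 0 < a₁ → a₁ ≤ a₂ → a₂ < 1 / 2 → ∃ c C₀ : ℝ, 0 < c ∧ 0 ≤ C₀ ∧
    ∀ (T t₁ t : ℝ) (S F : Set ℝ), t₁ ≤ t → t < T → MeasurableSet S → MeasurableSet F → S ⊆ Set.Icc t₁ t → Disjoint S F →
      (∀ t' ∈ S, ∃ a : ℝ, a₁ ≤ a ∧ a ≤ a₂ ∧ ∀ t'' : ℝ, t' + a * (T - t') ≤ t'' → t'' ≤ t' + 2 * a * (T - t') → t'' ∈ F) →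
      c * (∫ τ in t₁..t, Set.indicator S (fun _ => (1 : ℝ)) τ / (T - τ)) ≤
        (∫ τ in t₁..t, Set.indicator F (fun _ => (1 : ℝ)) τ / (T - τ)) + C₀

end Summit.NavierStokesRegularity.NavierStokesRegularity.Theorems.NearExtremalTransiencePerFlow.TransienceExit

end
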